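import Literature.Probability.Percolation.TwoClusterConditionalAssociationProofs
import HarnessLib

/-!
# Crux `PercNearOneGluing.AdditiveGluing` (stmt-CriticalPhenomena-4576), line `replica-splice-at-entrance` —
# stub `stub_localOpenConn` (connection events anchored off the cluster of `s` are `s`-local)

Helper file for the crux skeleton of the line `replica-splice-at-entrance` (lead
prover-line-stmt-CriticalPhenomena-4576-c2-0): proves exactly the registered stub signature
`stub_localOpenConn` together with the closure lemmas for the two pointwise predicates used by the
"local BHK" inequalities of the line (pure combinatorics of open paths, no measure theory); lands with
`--supports stmt-CriticalPhenomena-4576`.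

## Content

Fix a vertex `s`.  For a bond configuration `ω` write `C_s(ω) = openEdgeCluster ω s` for the open EDGE
cluster of `s` (van den Berg–Häggström–Kahn 2006) and
`W̄(ω) = {e | ∃ v ∈ e, v = s ∨ ∃ e' ∈ C_s(ω), v ∈ e'}` for the set of pairs meeting the vertex set
`{s} ∪ V(C_s(ω))` (exactly the set spelled out in
`Literature/Probability/Percolation/TwoClusterConditionalAssociationProofs.lean`; no definition is
introduced here either, the set is written out in every statement).

* An event `G` is `s`-LOCAL off `X` when, on `{s ↮ X}`, membership of `ω` in `G` only depends on `ω`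
  with the pairs of `W̄(ω)` deleted:
  `∀ ω, (∀ x ∈ X, ¬ s ↔ x) → (ω ∈ G ↔ ω \ W̄(ω) ∈ G)`.
  This predicate is closed under `∩`, `∪`, complements and (bounded) indexed `⋂`/`⋃`
  (`localEvent_inter`, `localEvent_union`, `localEvent_compl`, `localEvent_iInter`,
  `localEvent_iUnion`, …) — pointwise propositional logic.
* `{x ↔ y}` is `s`-local off `X` as soon as `x ∈ X` (or `y ∈ X`): `stub_localOpenConn`,
  `localOpenConn_symm`, and the unbundled form `localOpenConn_of_not_reachable` (hypothesis `s ↮ x` only).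
  Proof: if `s ↮ x` then `x ∉ {s} ∪ V(C_s)`, so by `BHK2006.openEdgeCluster_eq_sdiff_bar` the edge
  cluster of `x` is the same in `ω` and in `ω \ W̄(ω)`, and `x ↔ y` is read off the edge cluster of `x`
  (`reachable_iff_exists_mem_openEdgeCluster`).  (Informally: an open path from `x` never touches
  `{s} ∪ V(C_s)`, else `s ↔ x`.)
* INCREASING events `∀ ω ω', ω ∈ G → ω ⊆ ω' → ω' ∈ G`: `{x ↔ y}` is increasing
  (`increasing_openConn`), and the class is closed under `∩`, `∪`, bounded `⋂`/`⋃`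
  (`increasing_inter`, `increasing_union`, `increasing_iInter`, `increasing_iUnion`).

Sources: van den Berg–Häggström–Kahn, *Ann. Probab.* 34 (2006), §1 (definition of `C_s`, `W̄`, proof
of Thm. 1.5); Grimmett, *Percolation* (1999), §§1.3, 2.1 (connection events are increasing).  Not here:
any probability (the local BHK inequalities themselves are the neighbouring stubs of the line).
-/

namespace Summit.CriticalPhenomena.PercolationContinuityZ3.Theorems

open MeasureTheory Literature.Probability.LatticeModels Literature.Probability.Percolation
open scoped Classical BigOperators

/-! ### Increasing events -/

section Increasing

variable {V : Type*}

/-- `{x ↔ y}` is an increasing event: adding open edges preserves open paths.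
(Grimmett 1999, §2.1, examples of increasing events.) -/
theorem increasing_openConn (x y : V) :
    ∀ ω ω' : BondConfig V, ω ∈ openConn x y → ω ⊆ ω' → ω' ∈ openConn x y :=
  fun _ _ hω h => SimpleGraph.Reachable.mono (BHK2006.openGraph_le h) hω

/-- The intersection of two increasing events is increasing. [folklore] -/
theorem increasing_inter {G₁ G₂ : Set (BondConfig V)}
    (h₁ : ∀ ω ω' : BondConfig V, ω ∈ G₁ → ω ⊆ ω' → ω' ∈ G₁)
    (h₂ : ∀ ω ω' : BondConfig V, ω ∈ G₂ → ω ⊆ ω' → ω' ∈ G₂) :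
    ∀ ω ω' : BondConfig V, ω ∈ G₁ ∩ G₂ → ω ⊆ ω' → ω' ∈ G₁ ∩ G₂ :=
  fun ω ω' hω h => ⟨h₁ ω ω' hω.1 h, h₂ ω ω' hω.2 h⟩

/-- The union of two increasing events is increasing. [folklore] -/
theorem increasing_union {G₁ G₂ : Set (BondConfig V)}
    (h₁ : ∀ ω ω' : BondConfig V, ω ∈ G₁ → ω ⊆ ω' → ω' ∈ G₁)
    (h₂ : ∀ ω ω' : BondConfig V, ω ∈ G₂ → ω ⊆ ω' → ω' ∈ G₂) :
    ∀ ω ω' : BondConfig V, ω ∈ G₁ ∪ G₂ → ω ⊆ ω' → ω' ∈ G₁ ∪ G₂ :=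
  fun ω ω' hω h => hω.imp (fun h' => h₁ ω ω' h' h) (fun h' => h₂ ω ω' h' h)

/-- An indexed intersection of increasing events is increasing. [folklore] -/
theorem increasing_iInter' {ι : Sort*} {G : ι → Set (BondConfig V)}
    (hG : ∀ i, ∀ ω ω' : BondConfig V, ω ∈ G i → ω ⊆ ω' → ω' ∈ G i) :
    ∀ ω ω' : BondConfig V, ω ∈ (⋂ i, G i) → ω ⊆ ω' → ω' ∈ ⋂ i, G i :=
  fun ω ω' hω h => Set.mem_iInter.2 fun i => hG i ω ω' (Set.mem_iInter.1 hω i) h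

/-- An indexed union of increasing events is increasing. [folklore] -/
theorem increasing_iUnion' {ι : Sort*} {G : ι → Set (BondConfig V)}
    (hG : ∀ i, ∀ ω ω' : BondConfig V, ω ∈ G i → ω ⊆ ω' → ω' ∈ G i) :
    ∀ ω ω' : BondConfig V, ω ∈ (⋃ i, G i) → ω ⊆ ω' → ω' ∈ ⋃ i, G i := by
  intro ω ω' hω h
  obtain ⟨i, hi⟩ := Set.mem_iUnion.1 hω
  exact Set.mem_iUnion.2 ⟨i, hG i ω ω' hi h⟩

/-- A finite intersection `⋂ i ∈ I, G i` of increasing events is increasing. [folklore] -/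
theorem increasing_iInter {ι : Type*} (I : Finset ι) {G : ι → Set (BondConfig V)}
    (hG : ∀ i ∈ I, ∀ ω ω' : BondConfig V, ω ∈ G i → ω ⊆ ω' → ω' ∈ G i) :
    ∀ ω ω' : BondConfig V, ω ∈ (⋂ i ∈ I, G i) → ω ⊆ ω' → ω' ∈ ⋂ i ∈ I, G i := by
  intro ω ω' hω h
  simp only [Set.mem_iInter] at hω ⊢
  exact fun i hi => hG i hi ω ω' (hω i hi) h

/-- A finite union `⋃ i ∈ I, G i` of increasing events is increasing. [folklore] -/
theorem increasing_iUnion {ι : Type*} (I : Finset ι) {G : ι → Set (BondConfig V)}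
    (hG : ∀ i ∈ I, ∀ ω ω' : BondConfig V, ω ∈ G i → ω ⊆ ω' → ω' ∈ G i) :
    ∀ ω ω' : BondConfig V, ω ∈ (⋃ i ∈ I, G i) → ω ⊆ ω' → ω' ∈ ⋃ i ∈ I, G i := by
  intro ω ω' hω h
  simp only [Set.mem_iUnion, exists_prop] at hω ⊢
  obtain ⟨i, hi, hω⟩ := hω
  exact ⟨i, hi, hG i hi ω ω' hω h⟩

end Increasing

/-! ### `s`-local events: closure properties -/

section Local

variable {V : Type*}

/-- The intersection of two `s`-local events (off the same `X`) is `s`-local. [folklore] -/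
theorem localEvent_inter {s : V} {X : Set V} {G₁ G₂ : Set (BondConfig V)}
    (h₁ : ∀ ω : BondConfig V, (∀ x ∈ X, ¬ (openGraph ω).Reachable s x) →
      (ω ∈ G₁ ↔ ω \ {e | ∃ v ∈ e, v = s ∨ ∃ e' ∈ openEdgeCluster ω s, v ∈ e'} ∈ G₁))
    (h₂ : ∀ ω : BondConfig V, (∀ x ∈ X, ¬ (openGraph ω).Reachable s x) →
      (ω ∈ G₂ ↔ ω \ {e | ∃ v ∈ e, v = s ∨ ∃ e' ∈ openEdgeCluster ω s, v ∈ e'} ∈ G₂)) :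
    ∀ ω : BondConfig V, (∀ x ∈ X, ¬ (openGraph ω).Reachable s x) →
      (ω ∈ G₁ ∩ G₂ ↔ ω \ {e | ∃ v ∈ e, v = s ∨ ∃ e' ∈ openEdgeCluster ω s, v ∈ e'} ∈ G₁ ∩ G₂) :=
  fun ω hω => and_congr (h₁ ω hω) (h₂ ω hω)

/-- The union of two `s`-local events (off the same `X`) is `s`-local. [folklore] -/
theorem localEvent_union {s : V} {X : Set V} {G₁ G₂ : Set (BondConfig V)}
    (h₁ : ∀ ω : BondConfig V, (∀ x ∈ X, ¬ (openGraph ω).Reachable s x) →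
      (ω ∈ G₁ ↔ ω \ {e | ∃ v ∈ e, v = s ∨ ∃ e' ∈ openEdgeCluster ω s, v ∈ e'} ∈ G₁))
    (h₂ : ∀ ω : BondConfig V, (∀ x ∈ X, ¬ (openGraph ω).Reachable s x) →
      (ω ∈ G₂ ↔ ω \ {e | ∃ v ∈ e, v = s ∨ ∃ e' ∈ openEdgeCluster ω s, v ∈ e'} ∈ G₂)) :
    ∀ ω : BondConfig V, (∀ x ∈ X, ¬ (openGraph ω).Reachable s x) →
      (ω ∈ G₁ ∪ G₂ ↔ ω \ {e | ∃ v ∈ e, v = s ∨ ∃ e' ∈ openEdgeCluster ω s, v ∈ e'} ∈ G₁ ∪ G₂) :=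
  fun ω hω => or_congr (h₁ ω hω) (h₂ ω hω)

/-- The complement of an `s`-local event is `s`-local. [folklore] -/
theorem localEvent_compl {s : V} {X : Set V} {G : Set (BondConfig V)}
    (h : ∀ ω : BondConfig V, (∀ x ∈ X, ¬ (openGraph ω).Reachable s x) →
      (ω ∈ G ↔ ω \ {e | ∃ v ∈ e, v = s ∨ ∃ e' ∈ openEdgeCluster ω s, v ∈ e'} ∈ G)) :
    ∀ ω : BondConfig V, (∀ x ∈ X, ¬ (openGraph ω).Reachable s x) →
      (ω ∈ Gᶜ ↔ ω \ {e | ∃ v ∈ e, v = s ∨ ∃ e' ∈ openEdgeCluster ω s, v ∈ e'} ∈ Gᶜ) :=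
  fun ω hω => not_congr (h ω hω)

/-- The set difference of two `s`-local events is `s`-local. [folklore] -/
theorem localEvent_diff {s : V} {X : Set V} {G₁ G₂ : Set (BondConfig V)}
    (h₁ : ∀ ω : BondConfig V, (∀ x ∈ X, ¬ (openGraph ω).Reachable s x) →
      (ω ∈ G₁ ↔ ω \ {e | ∃ v ∈ e, v = s ∨ ∃ e' ∈ openEdgeCluster ω s, v ∈ e'} ∈ G₁))
    (h₂ : ∀ ω : BondConfig V, (∀ x ∈ X, ¬ (openGraph ω).Reachable s x) →
      (ω ∈ G₂ ↔ ω \ {e | ∃ v ∈ e, v = s ∨ ∃ e' ∈ openEdgeCluster ω s, v ∈ e'} ∈ G₂)) :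
    ∀ ω : BondConfig V, (∀ x ∈ X, ¬ (openGraph ω).Reachable s x) →
      (ω ∈ G₁ \ G₂ ↔ ω \ {e | ∃ v ∈ e, v = s ∨ ∃ e' ∈ openEdgeCluster ω s, v ∈ e'} ∈ G₁ \ G₂) :=
  fun ω hω => and_congr (h₁ ω hω) (not_congr (h₂ ω hω))

/-- The sure event is `s`-local. [folklore] -/
theorem localEvent_univ (s : V) (X : Set V) :
    ∀ ω : BondConfig V, (∀ x ∈ X, ¬ (openGraph ω).Reachable s x) →
      (ω ∈ (Set.univ : Set (BondConfig V)) ↔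
        ω \ {e | ∃ v ∈ e, v = s ∨ ∃ e' ∈ openEdgeCluster ω s, v ∈ e'} ∈ (Set.univ : Set (BondConfig V))) :=
  fun _ _ => iff_of_true trivial trivial

/-- The impossible event is `s`-local. [folklore] -/
theorem localEvent_empty (s : V) (X : Set V) :
    ∀ ω : BondConfig V, (∀ x ∈ X, ¬ (openGraph ω).Reachable s x) →
      (ω ∈ (∅ : Set (BondConfig V)) ↔
        ω \ {e | ∃ v ∈ e, v = s ∨ ∃ e' ∈ openEdgeCluster ω s, v ∈ e'} ∈ (∅ : Set (BondConfig V))) :=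
  fun _ _ => iff_of_false id id

/-- An indexed intersection of `s`-local events is `s`-local (arbitrary index sort). [folklore] -/
theorem localEvent_iInter' {ι : Sort*} {s : V} {X : Set V} {G : ι → Set (BondConfig V)}
    (hG : ∀ i, ∀ ω : BondConfig V, (∀ x ∈ X, ¬ (openGraph ω).Reachable s x) →
      (ω ∈ G i ↔ ω \ {e | ∃ v ∈ e, v = s ∨ ∃ e' ∈ openEdgeCluster ω s, v ∈ e'} ∈ G i)) :
    ∀ ω : BondConfig V, (∀ x ∈ X, ¬ (openGraph ω).Reachable s x) →
      (ω ∈ (⋂ i, G i) ↔ ω \ {e | ∃ v ∈ e, v = s ∨ ∃ e' ∈ openEdgeCluster ω s, v ∈ e'} ∈ ⋂ i, G i) :=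
  fun ω hω => by
    simp only [Set.mem_iInter]
    exact forall_congr' fun i => hG i ω hω

/-- An indexed union of `s`-local events is `s`-local (arbitrary index sort). [folklore] -/
theorem localEvent_iUnion' {ι : Sort*} {s : V} {X : Set V} {G : ι → Set (BondConfig V)}
    (hG : ∀ i, ∀ ω : BondConfig V, (∀ x ∈ X, ¬ (openGraph ω).Reachable s x) →
      (ω ∈ G i ↔ ω \ {e | ∃ v ∈ e, v = s ∨ ∃ e' ∈ openEdgeCluster ω s, v ∈ e'} ∈ G i)) :
    ∀ ω : BondConfig V, (∀ x ∈ X, ¬ (openGraph ω).Reachable s x) →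
      (ω ∈ (⋃ i, G i) ↔ ω \ {e | ∃ v ∈ e, v = s ∨ ∃ e' ∈ openEdgeCluster ω s, v ∈ e'} ∈ ⋃ i, G i) :=
  fun ω hω => by
    simp only [Set.mem_iUnion]
    exact exists_congr fun i => hG i ω hω

/-- A finite intersection `⋂ i ∈ I, G i` of `s`-local events is `s`-local. [folklore] -/
theorem localEvent_iInter {ι : Type*} (I : Finset ι) {s : V} {X : Set V}
    {G : ι → Set (BondConfig V)}
    (hG : ∀ i ∈ I, ∀ ω : BondConfig V, (∀ x ∈ X, ¬ (openGraph ω).Reachable s x) →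
      (ω ∈ G i ↔ ω \ {e | ∃ v ∈ e, v = s ∨ ∃ e' ∈ openEdgeCluster ω s, v ∈ e'} ∈ G i)) :
    ∀ ω : BondConfig V, (∀ x ∈ X, ¬ (openGraph ω).Reachable s x) →
      (ω ∈ (⋂ i ∈ I, G i) ↔
        ω \ {e | ∃ v ∈ e, v = s ∨ ∃ e' ∈ openEdgeCluster ω s, v ∈ e'} ∈ ⋂ i ∈ I, G i) :=
  fun ω hω => by
    simp only [Set.mem_iInter]
    exact forall₂_congr fun i hi => hG i hi ω hω

/-- A finite union `⋃ i ∈ I, G i` of `s`-local events is `s`-local. [folklore] -/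
theorem localEvent_iUnion {ι : Type*} (I : Finset ι) {s : V} {X : Set V}
    {G : ι → Set (BondConfig V)}
    (hG : ∀ i ∈ I, ∀ ω : BondConfig V, (∀ x ∈ X, ¬ (openGraph ω).Reachable s x) →
      (ω ∈ G i ↔ ω \ {e | ∃ v ∈ e, v = s ∨ ∃ e' ∈ openEdgeCluster ω s, v ∈ e'} ∈ G i)) :
    ∀ ω : BondConfig V, (∀ x ∈ X, ¬ (openGraph ω).Reachable s x) →
      (ω ∈ (⋃ i ∈ I, G i) ↔
        ω \ {e | ∃ v ∈ e, v = s ∨ ∃ e' ∈ openEdgeCluster ω s, v ∈ e'} ∈ ⋃ i ∈ I, G i) :=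
  fun ω hω => by
    simp only [Set.mem_iUnion, exists_prop]
    exact exists_congr fun i => and_congr_right fun hi => hG i hi ω hω

/-- Enlarging the anchor set `X` preserves `s`-locality (fewer configurations to check). [folklore] -/
theorem localEvent_mono {s : V} {X X' : Set V} (hXX' : X ⊆ X') {G : Set (BondConfig V)}
    (h : ∀ ω : BondConfig V, (∀ x ∈ X, ¬ (openGraph ω).Reachable s x) →
      (ω ∈ G ↔ ω \ {e | ∃ v ∈ e, v = s ∨ ∃ e' ∈ openEdgeCluster ω s, v ∈ e'} ∈ G)) :
    ∀ ω : BondConfig V, (∀ x ∈ X', ¬ (openGraph ω).Reachable s x) →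
      (ω ∈ G ↔ ω \ {e | ∃ v ∈ e, v = s ∨ ∃ e' ∈ openEdgeCluster ω s, v ∈ e'} ∈ G) :=
  fun ω hω => h ω fun x hx => hω x (hXX' hx)

end Local

/-! ### Connection events anchored off the cluster of `s` -/

section Conn

variable {V : Type*}

/-- **`{x ↔ y}` is local off the cluster of `s`.**  If `s ↮ x` in `ω`, then `x ↔ y` holds in `ω` iff
it holds in `ω` with every pair meeting `{s} ∪ V(C_s(ω))` deleted: the open edge cluster of `x` is the
same in both configurations (van den Berg–Häggström–Kahn 2006, proof of Thm. 1.5: "the conditional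
distribution of `C_t` [given `C_s = W`] is the same as that for the restriction … to the graph obtained
by deleting all edges in `W̄`"), and `x ↔ y` is read off that cluster. [folklore] -/
theorem localOpenConn_of_not_reachable {s x : V} (y : V) {ω : BondConfig V}
    (hx : ¬ (openGraph ω).Reachable s x) :
    ω ∈ openConn x y ↔
      ω \ {e | ∃ v ∈ e, v = s ∨ ∃ e' ∈ openEdgeCluster ω s, v ∈ e'} ∈ openConn x y := by
  have hxs : ¬ (x = s ∨ ∃ e ∈ openEdgeCluster ω s, x ∈ e) := fun h =>
    hx ((reachable_iff_exists_mem_openEdgeCluster ω s x).2 h)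
  have hC : openEdgeCluster ω x =
      openEdgeCluster (ω \ {e | ∃ v ∈ e, v = s ∨ ∃ e' ∈ openEdgeCluster ω s, v ∈ e'}) x :=
    BHK2006.openEdgeCluster_eq_sdiff_bar rfl hxs
  show (openGraph ω).Reachable x y ↔
    (openGraph (ω \ {e | ∃ v ∈ e, v = s ∨ ∃ e' ∈ openEdgeCluster ω s, v ∈ e'})).Reachable x y
  rw [reachable_iff_exists_mem_openEdgeCluster, reachable_iff_exists_mem_openEdgeCluster, hC]

/-- Symmetric form of `localOpenConn_of_not_reachable`: `{y ↔ x}` is local off the cluster of `s`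
whenever `s ↮ x`. [folklore] -/
theorem localOpenConn_of_not_reachable' {s x : V} (y : V) {ω : BondConfig V}
    (hx : ¬ (openGraph ω).Reachable s x) :
    ω ∈ openConn y x ↔
      ω \ {e | ∃ v ∈ e, v = s ∨ ∃ e' ∈ openEdgeCluster ω s, v ∈ e'} ∈ openConn y x := by
  have h := localOpenConn_of_not_reachable y hx
  simp only [openConn, Set.mem_setOf_eq] at h ⊢
  rw [SimpleGraph.reachable_comm, h, SimpleGraph.reachable_comm]

end Conn

/-- Registered stub `stub_localOpenConn` of crux stmt-CriticalPhenomena-4576 (line replica-splice-at-entrance):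
**a connection event anchored in `X` is `s`-local off `X`.**  On `{s ↮ X}` and for `x ∈ X`, `x ↔ y`
holds in `ω` iff it holds in `ω` with all pairs meeting `{s} ∪ V(C_s(ω))` removed (`C_s` = the open edge
cluster of `s`, van den Berg–Häggström–Kahn 2006, §1). [folklore] -/
theorem stub_localOpenConn :
    ∀ (n : ℕ) (s x y : Fin n) (X : Set (Fin n)), x ∈ X → ∀ ω : BondConfig (Fin n),
      (∀ x' ∈ X, ¬ (openGraph ω).Reachable s x') →
      (ω ∈ openConn x y ↔ ω \ {e | ∃ v ∈ e, v = s ∨ ∃ e' ∈ openEdgeCluster ω s, v ∈ e'} ∈ openConn x y) := by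
  intro n s x y X hx ω hω
  exact localOpenConn_of_not_reachable y (hω x hx)

/-- Companion of `stub_localOpenConn` with the anchor on the right: on `{s ↮ X}` and for `x ∈ X`,
`{y ↔ x}` is `s`-local off `X`. [folklore] -/
theorem localOpenConn_symm :
    ∀ (n : ℕ) (s x y : Fin n) (X : Set (Fin n)), x ∈ X → ∀ ω : BondConfig (Fin n),
      (∀ x' ∈ X, ¬ (openGraph ω).Reachable s x') →
      (ω ∈ openConn y x ↔ ω \ {e | ∃ v ∈ e, v = s ∨ ∃ e' ∈ openEdgeCluster ω s, v ∈ e'} ∈ openConn y x) := by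
  intro n s x y X hx ω hω
  exact localOpenConn_of_not_reachable' y (hω x hx)

end Summit.CriticalPhenomena.PercolationContinuityZ3.Theorems
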